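import Summits.NavierStokesRegularity.NavierStokesRegularity.Theorems.GaldiLiouvilleGateAllAxesTestedHessian
import Literature.Analysis.FluidPDE.AxisymmetricEuler
import HarnessLib

/-!
# Galdi's Liouville problem ⟨0895⟩, line «all-axes cylinder budget», piece O1c (4/·):
# the cylindrical test function `ψ(x) = χ(x₃) · M(x₁² + x₂²)` — Hessian and Laplacian in coordinates

Route `GaldiLiouvilleGate`, items ⟨0895⟩/⟨0896⟩; LINE allaxes/cylbudget, combined Defs v3.1
(817120c4c833a18a), obligation O1c′ `CylinderBookkeepingSplit` (BLUEPRINT Remark 15).  For smooth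
one-variable `χ, M` (`M′ = N/2`) the function `ψ(x) = χ(x₂) M(s)`, `s = x₀² + x₁²`
(coordinates `x 0, x 1, x 2` of `EuclideanSpace ℝ (Fin 3)`), satisfies, with `ρ = x₀U₀ + x₁U₁`:

  `D²ψ(x)(U,U) = χ(x₂)[N(s)(U₀²+U₁²) + 2N′(s)ρ²] + 2χ′(x₂)N(s)ρU₂ + χ″(x₂)M(s)U₂²`,
  `Δψ(x) = χ(x₂)(2N(s) + 2sN′(s)) + χ″(x₂)M(s)`.

* `fderiv_fderiv_eq_of_line` — `D²f(x)(v,v)` is the second derivative of `τ ↦ f(x + τv)` at `0`;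
* `hessian_cylTest_apply`, `laplacian_cylTest` — the two displays;
* `contDiff_cylTest`, `hasCompactSupport_cylTest` — admissibility of `ψ` in the tested identity.

[folklore]  No summit / no ⟨0895⟩–⟨0896⟩ claim is proved here; NS regularity is not touched.
-/

noncomputable section

-- the problem directory repeats the summit name (D-0017); core's `dupNamespace` linter fires
set_option linter.dupNamespace false

open MeasureTheory Set Filter Topology InnerProductSpace Function Metric
open scoped RealInnerProductSpace Laplacian Topology

namespace Summit.NavierStokesRegularity.NavierStokesRegularity.Theorems.GaldiLiouville.AllAxesBudget

open Literature.Analysis.FluidPDE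

/-! ### Second derivatives along lines -/

section Line

variable {E : Type*} [NormedAddCommGroup E] [InnerProductSpace ℝ E]

/-- **`D²f(x)(v, v)` along the line.**  For `f ∈ C²(E; ℝ)`: if `G(τ) = f(x + τ v)` has derivative
`g₁ τ` at every `τ` and `g₁` has derivative `g₂` at `0`, then `fderiv (fderiv f) x v v = g₂`. [folklore] -/
theorem fderiv_fderiv_eq_of_line {f : E → ℝ} (hf : ContDiff ℝ 2 f) (x v : E) {g₁ : ℝ → ℝ} {g₂ : ℝ}
    (h₁ : ∀ τ : ℝ, HasDerivAt (fun σ : ℝ => f (x + σ • v)) (g₁ τ) τ) (h₂ : HasDerivAt g₁ g₂ 0) :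
    fderiv ℝ (fderiv ℝ f) x v v = g₂ := by
  -- `D²f(x)(v,v) = D(y ↦ Df(y) v)(x) v`
  have e1 : fderiv ℝ (fderiv ℝ f) x v v = fderiv ℝ (fun y => fderiv ℝ f y v) x v := by
    rw [fderiv_fderiv_apply_const hf x v, iteratedFDeriv_two_apply]; rfl
  rw [e1]
  -- the scalar function `F y = Df(y) v` is differentiable
  set F : E → ℝ := fun y => fderiv ℝ f y v with hF
  have hfd : Differentiable ℝ f := hf.differentiable (by norm_num)
  have hF1 : ContDiff ℝ 1 F := (hf.fderiv_right (m := 1) le_rfl).clm_apply contDiff_const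
  have hFd : DifferentiableAt ℝ F x := hF1.differentiable one_ne_zero x
  -- `DF(x) v` is the line derivative
  have hline : HasDerivAt (fun τ : ℝ => F (x + τ • v)) (fderiv ℝ F x v) 0 :=
    hFd.hasFDerivAt.hasLineDerivAt v
  -- along the line, `F (x + τ v) = g₁ τ`
  have hFg : (fun τ : ℝ => F (x + τ • v)) = g₁ := by
    funext τ
    have hτ : HasDerivAt (fun σ : ℝ => f ((x + τ • v) + σ • v)) (fderiv ℝ f (x + τ • v) v) 0 :=
      (hfd (x + τ • v)).hasFDerivAt.hasLineDerivAt v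
    have hshift : HasDerivAt (fun σ : ℝ => f (x + (τ + σ) • v)) (g₁ τ) 0 := by
      have := (h₁ (τ + 0)).comp_const_add τ 0
      rwa [add_zero] at this
    have heq : (fun σ : ℝ => f ((x + τ • v) + σ • v)) = fun σ => f (x + (τ + σ) • v) := by
      funext σ; rw [add_smul, add_assoc]
    rw [heq] at hτ
    simpa using hτ.unique hshift
  rw [hFg] at hline
  exact hline.unique h₂ ▸ rfl

end Line

/-! ### The cylindrical test function -/

section Cyl

variable {χ M N : ℝ → ℝ}

/-- Coordinates of `x + σ • U`. [folklore] -/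
theorem coord_add_smul (x U : (EuclideanSpace ℝ (Fin 3))) (σ : ℝ) (i : Fin 3) : (x + σ • U) i = x i + σ * U i := by
  simp [PiLp.add_apply, PiLp.smul_apply, smul_eq_mul]

/-- The coordinate maps of `EuclideanSpace ℝ (Fin 3)` are smooth. [folklore] -/
theorem contDiff_coord (i : Fin 3) {n : WithTop ℕ∞} : ContDiff ℝ n fun y : (EuclideanSpace ℝ (Fin 3)) => y i :=
  (EuclideanSpace.proj (𝕜 := ℝ) i).contDiff

/-- `ψ(x) = χ(x₂) M(x₀² + x₁²)` is `C^n` when `χ, M` are. [folklore] -/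
theorem contDiff_cylTest {n : WithTop ℕ∞} (hχ : ContDiff ℝ n χ) (hM : ContDiff ℝ n M) :
    ContDiff ℝ n fun y : (EuclideanSpace ℝ (Fin 3)) => χ (y 2) * M (y 0 ^ 2 + y 1 ^ 2) :=
  (hχ.comp (contDiff_coord 2)).mul (hM.comp (((contDiff_coord 0).pow 2).add ((contDiff_coord 1).pow 2)))

/-- `ψ` has compact support when `χ` vanishes on `|z| ≥ Z₁` and `M` vanishes on `[S₁, ∞)`. [folklore] -/
theorem hasCompactSupport_cylTest {Z₁ S₁ : ℝ} (hS₁ : 0 ≤ S₁) (hχ0 : ∀ z, Z₁ ≤ |z| → χ z = 0)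
    (hM0 : ∀ s, S₁ ≤ s → M s = 0) :
    HasCompactSupport fun y : (EuclideanSpace ℝ (Fin 3)) => χ (y 2) * M (y 0 ^ 2 + y 1 ^ 2) := by
  refine HasCompactSupport.of_support_subset_isCompact
    (isCompact_closedBall (0 : (EuclideanSpace ℝ (Fin 3))) (Real.sqrt (Z₁ ^ 2 + S₁))) ?_
  intro y hy
  rw [mem_closedBall, dist_zero_right]
  by_contra hlt
  rw [not_le] at hlt
  have h0 : 0 ≤ Z₁ ^ 2 + S₁ := by positivity
  have hn : ‖y‖ ^ 2 = y 0 ^ 2 + y 1 ^ 2 + y 2 ^ 2 := by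
    -- (= `SereginSverak2009.norm_sq_eq_three`, not imported to keep the closure small)
    rw [EuclideanSpace.norm_sq_eq, Fin.sum_univ_three]
    simp [Real.norm_eq_abs, sq_abs]
  have hgt : Z₁ ^ 2 + S₁ < y 0 ^ 2 + y 1 ^ 2 + y 2 ^ 2 := by
    rw [← hn]
    have h1 : Real.sqrt (Z₁ ^ 2 + S₁) ^ 2 = Z₁ ^ 2 + S₁ := Real.sq_sqrt h0
    nlinarith [Real.sqrt_nonneg (Z₁ ^ 2 + S₁), norm_nonneg y]
  apply hy
  show χ (y 2) * M (y 0 ^ 2 + y 1 ^ 2) = 0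
  by_cases h2 : Z₁ ^ 2 < y 2 ^ 2
  · have : Z₁ ≤ |y 2| := by
      have h3 := Real.sqrt_lt_sqrt (sq_nonneg _) h2
      rw [Real.sqrt_sq_eq_abs, Real.sqrt_sq_eq_abs] at h3
      exact (le_abs_self Z₁).trans h3.le
    rw [hχ0 _ this, zero_mul]
  · rw [not_lt] at h2
    have : S₁ ≤ y 0 ^ 2 + y 1 ^ 2 := by linarith
    rw [hM0 _ this, mul_zero]

/-- One-variable chain rule helper: `σ ↦ f(a + σ b)` has derivative `f′(a + τ b) · b` at `τ` for
differentiable `f`. [folklore] -/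
theorem hasDerivAt_comp_affine {f : ℝ → ℝ} (hf : Differentiable ℝ f) (a b τ : ℝ) :
    HasDerivAt (fun σ : ℝ => f (a + σ * b)) (deriv f (a + τ * b) * b) τ := by
  have hin : HasDerivAt (fun σ : ℝ => a + σ * b) b τ := by
    simpa using ((hasDerivAt_id τ).mul_const b).const_add a
  exact (hf (a + τ * b)).hasDerivAt.comp τ hin

/-- The quadratic `q(σ) = (x₀ + σU₀)² + (x₁ + σU₁)²` along a line and its derivative. [folklore] -/
theorem hasDerivAt_lineQuad (x₀ x₁ U₀ U₁ τ : ℝ) :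
    HasDerivAt (fun σ : ℝ => (x₀ + σ * U₀) ^ 2 + (x₁ + σ * U₁) ^ 2)
      (2 * (x₀ + τ * U₀) * U₀ + 2 * (x₁ + τ * U₁) * U₁) τ := by
  have h0 : HasDerivAt (fun σ : ℝ => x₀ + σ * U₀) U₀ τ := by
    simpa using ((hasDerivAt_id τ).mul_const U₀).const_add x₀
  have h1 : HasDerivAt (fun σ : ℝ => x₁ + σ * U₁) U₁ τ := by
    simpa using ((hasDerivAt_id τ).mul_const U₁).const_add x₁
  have := (h0.pow 2).add (h1.pow 2)
  refine this.congr_deriv ?_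
  push_cast
  ring

/-- **The Hessian of the cylindrical test function along `U`.**  For `χ, M ∈ C²(ℝ)` with `M′ = N/2`,
`N` differentiable, `ψ(y) = χ(y₂) M(y₀² + y₁²)`, `s = x₀² + x₁²`, `ρ = x₀U₀ + x₁U₁`:
`D²ψ(x)(U,U) = χ(x₂)[N(s)(U₀²+U₁²) + 2N′(s)ρ²] + 2χ′(x₂)N(s)ρU₂ + χ″(x₂)M(s)U₂²`. [folklore] -/
theorem hessian_cylTest_apply (hχ : ContDiff ℝ 2 χ) (hM : ContDiff ℝ 2 M)
    (hMN : ∀ s, HasDerivAt M (N s / 2) s) (hN : Differentiable ℝ N) (x U : (EuclideanSpace ℝ (Fin 3))) :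
    fderiv ℝ (fderiv ℝ (fun y : (EuclideanSpace ℝ (Fin 3)) => χ (y 2) * M (y 0 ^ 2 + y 1 ^ 2))) x U U =
      χ (x 2) * (N (x 0 ^ 2 + x 1 ^ 2) * (U 0 ^ 2 + U 1 ^ 2) +
          2 * deriv N (x 0 ^ 2 + x 1 ^ 2) * (x 0 * U 0 + x 1 * U 1) ^ 2) +
        2 * deriv χ (x 2) * N (x 0 ^ 2 + x 1 ^ 2) * ((x 0 * U 0 + x 1 * U 1) * U 2) +
        deriv (deriv χ) (x 2) * M (x 0 ^ 2 + x 1 ^ 2) * U 2 ^ 2 := by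
  have hχd : Differentiable ℝ χ := hχ.differentiable (by norm_num)
  have hχ'd : Differentiable ℝ (deriv χ) :=
    ((contDiff_succ_iff_deriv.1 (show ContDiff ℝ ((1 : ℕ∞) + 1) χ from hχ)).2.2).differentiable one_ne_zero
  have hMd : Differentiable ℝ M := fun s => (hMN s).differentiableAt
  -- the function along the line and its first derivative `g₁`
  set q : ℝ → ℝ := fun σ => (x 0 + σ * U 0) ^ 2 + (x 1 + σ * U 1) ^ 2 with hq
  set q' : ℝ → ℝ := fun σ => 2 * (x 0 + σ * U 0) * U 0 + 2 * (x 1 + σ * U 1) * U 1 with hq'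
  set g₁ : ℝ → ℝ := fun τ => deriv χ (x 2 + τ * U 2) * U 2 * M (q τ) +
    χ (x 2 + τ * U 2) * (N (q τ) / 2 * q' τ) with hg₁
  have hline : (fun σ : ℝ => (fun y : (EuclideanSpace ℝ (Fin 3)) => χ (y 2) * M (y 0 ^ 2 + y 1 ^ 2)) (x + σ • U)) =
      fun σ => χ (x 2 + σ * U 2) * M (q σ) := by
    funext σ; simp only [coord_add_smul, hq]
  have h₁ : ∀ τ : ℝ, HasDerivAt (fun σ : ℝ => (fun y : (EuclideanSpace ℝ (Fin 3)) => χ (y 2) * M (y 0 ^ 2 + y 1 ^ 2)) (x + σ • U)) (g₁ τ) τ := by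
    intro τ
    rw [hline]
    have hA := hasDerivAt_comp_affine hχd (x 2) (U 2) τ
    have hB : HasDerivAt (fun σ => M (q σ)) (N (q τ) / 2 * q' τ) τ :=
      (hMN (q τ)).comp τ (hasDerivAt_lineQuad (x 0) (x 1) (U 0) (U 1) τ)
    exact hA.fun_mul hB
  -- the second derivative at `0`
  have d1 : HasDerivAt (fun τ : ℝ => deriv χ (x 2 + τ * U 2)) (deriv (deriv χ) (x 2 + 0 * U 2) * U 2) 0 :=
    hasDerivAt_comp_affine hχ'd (x 2) (U 2) 0
  have d2 : HasDerivAt (fun τ => M (q τ)) (N (q 0) / 2 * q' 0) 0 :=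
    (hMN (q 0)).comp 0 (hasDerivAt_lineQuad (x 0) (x 1) (U 0) (U 1) 0)
  have d3 : HasDerivAt (fun τ : ℝ => χ (x 2 + τ * U 2)) (deriv χ (x 2 + 0 * U 2) * U 2) 0 :=
    hasDerivAt_comp_affine hχd (x 2) (U 2) 0
  have d4 : HasDerivAt (fun τ => N (q τ) / 2) (deriv N (q 0) * q' 0 / 2) 0 :=
    ((hN (q 0)).hasDerivAt.comp 0 (hasDerivAt_lineQuad (x 0) (x 1) (U 0) (U 1) 0)).div_const 2
  have d5 : HasDerivAt q' (2 * U 0 * U 0 + 2 * U 1 * U 1) 0 := by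
    have h0 : HasDerivAt (fun σ : ℝ => 2 * (x 0 + σ * U 0) * U 0) (2 * U 0 * U 0) 0 := by
      simpa using ((((hasDerivAt_id (0 : ℝ)).mul_const (U 0)).const_add (x 0)).const_mul 2).mul_const (U 0)
    have h1 : HasDerivAt (fun σ : ℝ => 2 * (x 1 + σ * U 1) * U 1) (2 * U 1 * U 1) 0 := by
      simpa using ((((hasDerivAt_id (0 : ℝ)).mul_const (U 1)).const_add (x 1)).const_mul 2).mul_const (U 1)
    exact h0.add h1
  have h₂ : HasDerivAt g₁
      ((deriv (deriv χ) (x 2 + 0 * U 2) * U 2 * U 2 * M (q 0) +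
          deriv χ (x 2 + 0 * U 2) * U 2 * (N (q 0) / 2 * q' 0)) +
        (deriv χ (x 2 + 0 * U 2) * U 2 * (N (q 0) / 2 * q' 0) +
          χ (x 2 + 0 * U 2) * (deriv N (q 0) * q' 0 / 2 * q' 0 + N (q 0) / 2 * (2 * U 0 * U 0 + 2 * U 1 * U 1)))) 0 :=
    ((d1.mul_const (U 2)).fun_mul d2).fun_add (d3.fun_mul (d4.fun_mul d5))
  rw [fderiv_fderiv_eq_of_line (contDiff_cylTest hχ hM) x U h₁ h₂]
  simp only [hq, hq', zero_mul, add_zero]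
  ring

/-- **The Laplacian of the cylindrical test function.**  With the notation of `hessian_cylTest_apply`:
`Δψ(x) = χ(x₂)(2N(s) + 2sN′(s)) + χ″(x₂)M(s)`. [folklore] -/
theorem laplacian_cylTest (hχ : ContDiff ℝ 2 χ) (hM : ContDiff ℝ 2 M)
    (hMN : ∀ s, HasDerivAt M (N s / 2) s) (hN : Differentiable ℝ N) (x : (EuclideanSpace ℝ (Fin 3))) :
    (Δ (fun y : (EuclideanSpace ℝ (Fin 3)) => χ (y 2) * M (y 0 ^ 2 + y 1 ^ 2))) x =
      χ (x 2) * (2 * N (x 0 ^ 2 + x 1 ^ 2) + 2 * (x 0 ^ 2 + x 1 ^ 2) * deriv N (x 0 ^ 2 + x 1 ^ 2)) +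
        deriv (deriv χ) (x 2) * M (x 0 ^ 2 + x 1 ^ 2) := by
  have hψ : ContDiff ℝ 2 (fun y : (EuclideanSpace ℝ (Fin 3)) => χ (y 2) * M (y 0 ^ 2 + y 1 ^ 2)) := contDiff_cylTest hχ hM
  rw [laplacian_eq_sum_fderiv_fderiv (EuclideanSpace.basisFun (Fin 3) ℝ) hψ x]
  have hterm : ∀ i : Fin 3, fderiv ℝ (fun y => fderiv ℝ (fun y : (EuclideanSpace ℝ (Fin 3)) => χ (y 2) * M (y 0 ^ 2 + y 1 ^ 2)) y
      ((EuclideanSpace.basisFun (Fin 3) ℝ) i)) x ((EuclideanSpace.basisFun (Fin 3) ℝ) i) =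
      fderiv ℝ (fderiv ℝ (fun y : (EuclideanSpace ℝ (Fin 3)) => χ (y 2) * M (y 0 ^ 2 + y 1 ^ 2))) x
        (EuclideanSpace.single i 1) (EuclideanSpace.single i 1) := by
    intro i
    rw [fderiv_fderiv_apply_const hψ x, iteratedFDeriv_two_apply]
    simp
  simp_rw [hterm, hessian_cylTest_apply hχ hM hMN hN x]
  rw [Fin.sum_univ_three]
  simp
  ring

end Cyl

end Summit.NavierStokesRegularity.NavierStokesRegularity.Theorems.GaldiLiouville.AllAxesBudget

end
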